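import Summits.KontsevichZagierPeriods.KontsevichZagierPeriods.Theorems.GrothendieckLemniscaticSectorGlue
import Summits.KontsevichZagierPeriods.KontsevichZagierPeriods.Theorems.MzvKernelInKZ.Negative.EulerFour
import Summits.KontsevichZagierPeriods.KontsevichZagierPeriods.Theorems.MzvKernelInKZ.Negative.PiLine

/-!
# Euler's `π⁴ = 90·ζ(4)` as a move chain (stub `stub_eulerCross4`, line `sector-amalgamation`,
# crux `Grothendieck.SectorComplement`, stmt-KontsevichZagierPeriods-11102)

The weight-4 CROSS RELATION of the amalgamation line: every representation `p` of type `(0,0,4)`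
of the lemniscatic sector — literal (vacuous) domain condition and integrand `∏_{j<4} 1/(1+xⱼ²)`
on `ℝ⁴`, value `π⁴` — is congruent modulo `KZ.relations` to `90` copies of the simplex word
representation `[Δ₄, ω₀₀₀₁]` of `ζ(4) = π⁴/90`.

Proof: pure assembly of landed move chains, computed in the formal period ring
`P = FormalRep ⧸ relations` (`KZ.toFormalPeriod`, a `CommRing`):

* `p` is equivalent (identity change of variables, `equivalent_of_eqOn`) to the canonical monomial
  representation `m = p₁⁴` of type `(0,0,4)` (`exists_monoRep`), whose class is `⟦p₁⟧⁴` for a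
  representation `p₁ = [ℝ, 1/(1+x²)]` of `π` (`exists_piRep`);
* `⟦p₁⟧ = ⟦[ℝ, dt/(1+t²)]⟧ = 4·⟦[(0,1), dt/(1+t²)]⟧` (`line_univ_sub_four_mem`) and
  `⟦Q⟧ = 2·⟦[(0,1), dt/(1+t²)]⟧` (`Qrep_sub_two_line_mem`), so `⟦p₁⟧ = 2⟦Q⟧`;
* Fubini: `⟦G2⟧ = ⟦Q⟧²`, `⟦G4⟧ = ⟦G2⟧²` (`of_Qrep_mul_of_Qrep`, `of_G2_mul_of_G2`);
* Euler in the calculus: `45·⟦C4⟧ = 8·⟦G4⟧` (`fortyfive_C4_sub_eight_G4_mem`) and the cubical chart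
  `⟦C4⟧ = ⟦[Δ₄, ω₀₀₀₁]⟧` (`C4_sub_mem_changeOfVariablesRel`).

Hence `⟦p⟧ = ⟦p₁⟧⁴ = 16⟦Q⟧⁴ = 16⟦G4⟧ = 90⟦[Δ₄, ω₀₀₀₁]⟧`, and `toFormalPeriod_eq_zero_iff` concludes.

References: L. Euler (1735), `ζ(4) = π⁴/90`; M. Kontsevich, D. Zagier, *Periods* (2001), §1.1–§1.2, §4.1.
-/

noncomputable section

open MeasureTheory Set
open Literature.NumberTheory.Transcendental
open Literature.NumberTheory.Transcendental.KZ
open Summit.KontsevichZagierPeriods.Grothendieck.GpcLegendreLemniscaticNegative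
open Summit.KontsevichZagierPeriods.Grothendieck.LemniscaticSectorGlue
open Summit.KontsevichZagierPeriods.MzvKernelInKZ.Negative

namespace Summit.KontsevichZagierPeriods.Grothendieck.SectorComplementAmalgamation

/-- Any representation `[ℝ, 1/(1+x²)]` of `π` has the class of the line representation
`[ℝ, dt/(1+t²)]` of `PiLine.lean` (identity change of variables). [folklore] -/
private theorem toFormalPeriod_piRep_eq_lineRep (p : IntegralRep 1) (hpd : p.domain = univ)
    (hpi : p.integrand = fun x => 1 / (1 + x 0 ^ 2)) :
    toFormalPeriod (of p) = toFormalPeriod (of (lineRep univ sa_univ1)) :=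
  (equivalent_of_eqOn p (lineRep univ sa_univ1)
    ((show (lineRep univ sa_univ1).domain = univ from rfl).trans hpd.symm)
    (fun x _ => (congrFun hpi x).trans rfl)).toFormalPeriod_eq

/-- `⟦[ℝ, dt/(1+t²)]⟧ = 4·⟦[(0,1), dt/(1+t²)]⟧` in the formal period ring. [folklore] -/
private theorem toFormalPeriod_line_univ :
    toFormalPeriod (of (lineRep univ sa_univ1)) = 4 • toFormalPeriod (of (lineRep L01 sa_L01)) := by
  have h := toFormalPeriod_eq_zero_of_mem line_univ_sub_four_mem
  rw [map_sub, map_nsmul] at h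
  exact sub_eq_zero.mp h

/-- `⟦Q⟧ = 2·⟦[(0,1), dt/(1+t²)]⟧` in the formal period ring. [folklore] -/
private theorem toFormalPeriod_Qrep :
    toFormalPeriod (of Qrep) = 2 • toFormalPeriod (of (lineRep L01 sa_L01)) := by
  have h := toFormalPeriod_eq_zero_of_mem Qrep_sub_two_line_mem
  rw [map_sub, map_nsmul] at h
  exact sub_eq_zero.mp h

/-- Euler's `ζ(4) = π⁴/90` in the formal period ring: `45·⟦C4⟧ = 8·⟦G4⟧`. [folklore] -/
private theorem toFormalPeriod_fortyfive_C4 :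
    45 • toFormalPeriod (of C4) = 8 • toFormalPeriod (of G4) := by
  have h := toFormalPeriod_eq_zero_of_mem fortyfive_C4_sub_eight_G4_mem
  rw [map_sub, map_nsmul, map_nsmul] at h
  exact sub_eq_zero.mp h

/-- The cubical chart in the formal period ring: `⟦C4⟧ = ⟦[Δ₄, ω₀₀₀₁]⟧`. [folklore] -/
private theorem toFormalPeriod_C4 :
    toFormalPeriod (of C4) = toFormalPeriod (of (wordRep ω4 1 adm_ω4)) := by
  have h := toFormalPeriod_eq_zero_of_mem
    (changeOfVariablesRel_subset_relations C4_sub_mem_changeOfVariablesRel)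
  rw [map_sub] at h
  exact sub_eq_zero.mp h

/-- **Euler's `π⁴ = 90·ζ(4)` as a move chain across the junction** (registered stub
`stub_eulerCross4` of line `sector-amalgamation`): the lemniscatic monomial representation of type
`(0,0,4)`, `[ℝ⁴, ∏ⱼ 1/(1+xⱼ²)]` (value `π⁴`), is congruent to `90·[Δ₄, ω₀₀₀₁]`. Assembly of landed
chains: `[ℝ, 1/(1+t²)] ≡ 4·[(0,1), 1/(1+t²)]` (`line_univ_sub_four_mem`), `Q ≡ 2·[(0,1), 1/(1+t²)]`
(`Qrep_sub_two_line_mem`), Fubini `Q⁴ = G4`, `45·[C4] ≡ 8·[G4]` (`fortyfive_C4_sub_eight_G4_mem`),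
`[C4] ≡ [Δ₄, ω₀₀₀₁]` (cubical chart). [folklore] -/
theorem stub_eulerCross4 :
    ∀ (p : Literature.NumberTheory.Transcendental.KZ.IntegralRep ((0 + 0) + 4)),
      p.domain = {x | ∀ j : Fin (0 + 0), x (Fin.castAdd 4 j) ∈ Set.Ioo (0:ℝ) 1} →
      Set.EqOn p.integrand (fun x =>
        (∏ j : Fin 0, (1 / Real.sqrt ((1 - x (Fin.castAdd 4 (Fin.castAdd 0 j)) ^ 2) *
          (1 - x (Fin.castAdd 4 (Fin.castAdd 0 j)) ^ 2 / 2)))) *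
        (∏ j : Fin 0, (Real.sqrt (1 - x (Fin.castAdd 4 (Fin.natAdd 0 j)) ^ 2 / 2) /
          Real.sqrt (1 - x (Fin.castAdd 4 (Fin.natAdd 0 j)) ^ 2))) *
        ∏ j : Fin 4, (1 / (1 + x (Fin.natAdd (0 + 0) j) ^ 2))) p.domain →
      90 • Literature.NumberTheory.Transcendental.KZ.of
          (Summit.KontsevichZagierPeriods.MzvKernelInKZ.Negative.wordRep
            Summit.KontsevichZagierPeriods.MzvKernelInKZ.Negative.ω4 1
            Summit.KontsevichZagierPeriods.MzvKernelInKZ.Negative.adm_ω4) -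
        Literature.NumberTheory.Transcendental.KZ.of p ∈
        Literature.NumberTheory.Transcendental.KZ.relations := by
  intro p hpdom hpint
  obtain ⟨p₁, hpd, hpi⟩ := exists_piRep
  obtain ⟨m, hmd, hmi, hmP⟩ := exists_monoRep p₁ hpd hpi 0 0 4
  simp only [pow_zero, one_mul] at hmP
  -- `p` is the canonical monomial representation `m` up to an identity change of variables
  have hpm : toFormalPeriod (of p) = toFormalPeriod (of m) :=
    (equivalent_of_eqOn p m (by rw [hmd, hpdom]) (by rw [hmi]; exact hpint)).toFormalPeriod_eq
  have hp₁ := toFormalPeriod_piRep_eq_lineRep p₁ hpd hpi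
  have hU := toFormalPeriod_line_univ
  have hQ := toFormalPeriod_Qrep
  have hG2 : toFormalPeriod (of G2) = toFormalPeriod (of Qrep) * toFormalPeriod (of Qrep) := by
    rw [← map_mul, of_Qrep_mul_of_Qrep]
  have hG4 : toFormalPeriod (of G4) = toFormalPeriod (of G2) * toFormalPeriod (of G2) := by
    rw [← map_mul, of_G2_mul_of_G2]
  have h45 := toFormalPeriod_fortyfive_C4
  have hC4 := toFormalPeriod_C4
  rw [← toFormalPeriod_eq_zero_iff, map_sub, map_nsmul, hpm, hmP, hp₁]
  set W := toFormalPeriod (of (wordRep ω4 1 adm_ω4))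
  set C := toFormalPeriod (of C4)
  set G := toFormalPeriod (of G4)
  set G' := toFormalPeriod (of G2)
  set Q := toFormalPeriod (of Qrep)
  set U := toFormalPeriod (of (lineRep univ sa_univ1))
  set A := toFormalPeriod (of (lineRep L01 sa_L01))
  simp only [nsmul_eq_mul, Nat.cast_ofNat] at hU hQ h45 ⊢
  linear_combination 2 * h45 - 90 * hC4 + 16 * hG4 + 16 * (G' + Q ^ 2) * hG2
    + 16 * (Q ^ 2 + 4 * A ^ 2) * (Q + 2 * A) * hQ - (U + 4 * A) * (U ^ 2 + 16 * A ^ 2) * hU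

end Summit.KontsevichZagierPeriods.Grothendieck.SectorComplementAmalgamation

end
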